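import Literature.NumberTheory.DiophantineApproximation.RhinViolaIntegrals
import HarnessLib

/-!
# The polynomial case `j + k < m` of Rhin–Viola's `I_z^{(0)}` (RV 2005, Lemma 2.2, reduction step)

Topic `Literature/NumberTheory/DiophantineApproximation`. Everything here is PROVED (no definitions, no named
facts). Source: G. Rhin, C. Viola, *The permutation group method for the dilogarithm*, Ann. Sc. Norm. Super.
Pisa (5) 4 (2005) 389–437, Lemma 2.2 (p. 395): "if `j+k−m < 0`, then
`x^j(1−x)^h y^k(1−y)^l / (x(1−y)+yz)^{j+k−m+1} = S(x, y, z) ∈ ℤ[x, y, z]`", so that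
`z^{l+m} I_z^{(0)}(h,j,k,l,m) = ∫₀¹∫₀¹ S dx dy` is the integral of a POLYNOMIAL, to which the integrality
`d_A d_B ∫∫ S ∈ ℤ[z]` (`UnitSquarePolynomialIntegrality.lean`) applies. Here we carry out the reduction for the
tree's `RhinViola.integrand` / `RhinViola.I0`: off the corner `D = x(1−y)+yz = 0` the integrand IS the polynomial
`x^j(1−x)^h y^k(1−y)^l D^{m−j−k−1}`, and (the corner being null) `z^{l+m} I0 = ∫∫_{[0,1]²}` of it.

## References

* G. Rhin, C. Viola, Ann. Sc. Norm. Super. Pisa Cl. Sci. (5) 4 (2005) 389–437, Lemma 2.2. [RhinViola2005]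
-/

noncomputable section

namespace Literature.NumberTheory.DiophantineApproximation

namespace RhinViola

open _root_.MeasureTheory _root_.Set
open ViolaZudilin (unitSquare denom₁ mem_unitSquare measurableSet_unitSquare ae_fst_ne_zero_and_snd_ne_zero)

/-- **The integrand is a polynomial when `j + k < m`** (where `D = x(1−y)+yz ≠ 0`):
`integrand z h j k l m (x,y) = x^j(1−x)^h y^k(1−y)^l · D^{m−(j+k+1)}`. [cite: RhinViola2005, Lemma 2.2] -/
theorem integrand_of_lt {z : ℝ} {h j k l m : ℕ} (hm : j + k < m) {p : ℝ × ℝ} (hD : denom₁ z p ≠ 0) :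
    integrand z h j k l m p =
      p.1 ^ j * (1 - p.1) ^ h * p.2 ^ k * (1 - p.2) ^ l * denom₁ z p ^ (m - (j + k + 1)) := by
  rw [integrand]
  obtain ⟨e, rfl⟩ : ∃ e, m = j + k + 1 + e := ⟨m - (j + k + 1), by omega⟩
  rw [Nat.add_sub_cancel_left, pow_add]
  field_simp

/-- On the square with `x ≠ 0`, `y ∈ [0,1]` and `z ≥ 1` the denominator `D = x(1−y)+yz` does not vanish.
[folklore] -/
theorem denom₁_ne_zero_of_fst_ne_zero {z : ℝ} (hz : 1 ≤ z) {p : ℝ × ℝ} (hp : p ∈ unitSquare) (hx : p.1 ≠ 0) :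
    denom₁ z p ≠ 0 := by
  obtain ⟨⟨hx0, hx1⟩, hy0, hy1⟩ := mem_unitSquare.1 hp
  have hxpos : 0 < p.1 := lt_of_le_of_ne hx0 (Ne.symm hx)
  rw [denom₁]
  nlinarith [mul_nonneg hy0 (by linarith : (0 : ℝ) ≤ z - 1)]

/-- **Rhin–Viola Lemma 2.2, reduction step**: for `j + k < m` and `z ≥ 1`,
`z^{l+m} · I0 z h j k l m = ∫∫_{[0,1]²} x^j(1−x)^h y^k(1−y)^l (x(1−y)+yz)^{m−j−k−1} dx dy` — the integral of a
polynomial in `x, y, z` with integer coefficients. [cite: RhinViola2005, Lemma 2.2] -/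
theorem zpow_mul_I0_of_lt {z : ℝ} (hz : 1 ≤ z) {h j k l m : ℕ} (hm : j + k < m) :
    z ^ ((l : ℤ) + m) * I0 z h j k l m =
      ∫ p in unitSquare, p.1 ^ j * (1 - p.1) ^ h * p.2 ^ k * (1 - p.2) ^ l * denom₁ z p ^ (m - (j + k + 1)) := by
  have hz0 : z ≠ 0 := by positivity
  rw [I0, ← mul_assoc, ← zpow_add₀ hz0, add_neg_cancel, zpow_zero, one_mul]
  refine setIntegral_congr_ae measurableSet_unitSquare ?_
  filter_upwards [ae_fst_ne_zero_and_snd_ne_zero] with p hp hpU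
  exact integrand_of_lt hm (denom₁_ne_zero_of_fst_ne_zero hz hpU hp.1)

end RhinViola

end Literature.NumberTheory.DiophantineApproximation

end
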